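import Mathlib
import Literature.NumberTheory.LFunctions.Zhang2022.Section8XiZeroMajorant
import HarnessLib

/-!
# Zhang (2022) §8 p. 47: the absolute logarithmic mean of `ξ₀ⱼ(n;d,r)` — `XiZeroTailMean` HOLDS

Topic `Literature/NumberTheory/LFunctions/Zhang2022` (Landau–Siegel audit tree; verdict-neutral).
Y. Zhang, *Discrete mean estimates and the Landau–Siegel zero*, arXiv:2211.02515v1 (2022)
[Zhang2022LandauSiegel], §7 p. 33 (`λ(m,s)`, `λ₀ⱼ`, `λ̃₀ⱼ`, `κ̃₀ⱼ`, `ξ₀ⱼ(n;d,r)`) and §8 p. 47,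
display before (8.10), tex L2436–2437 ("Gathering these results together we conclude, by simple
approximation, that …") — **an unrefereed manuscript under adjudication** (campaign D-0069).

GAP-LEDGER row `G-d20-1` (DAG node `Z22:§8.u044`, consumer `DedStep8u044 → … → Skeleton.Ded823`,
and the same step in §9 `Ded97` and §10 `Ded1017`) isolated the in-cone estimate the "simple
approximation" silently uses: on the tail ranges `x = P_k/(dr) ≤ T` one needs
`Σ_{n<x} |ξ₀ⱼ(n;d,r)|/n ≪ 𝓛(1 + log x)³` uniformly in `d, r` (a `τ₃`-type bound; the crude
`τ₅`-type bound from `|κ| ≤ τ₄` loses). THIS FILE PROVES IT (`xiZeroTailMean`, the exact signature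
of the row, with an absolute constant and WITHOUT the factor `𝓛`, which is `≥ 1`):

* `|λ₀ⱼ(q)| ≤ 1 + 10B log q` for a prime `q` with `B log q ≤ 1/8`, `B = |b₁|+|b₂|+|b₃|` (the
  `j`-th factor of `λ(q,1−β_j)` is `1 − q⁻¹` up to unimodular perturbations `q^{−i(b_i−b_j)}`),
  hence `|λ̃₀ⱼ(n,dr)| ≤ Λ(n) = ∏_{q∣n}(1 + 10B log q)`;
* `|ξ₀ⱼ(n;d,r)| ≤ g(n) := Λ(n)·Σ_{k∣n} (|μ(k)|k/φ(k))·Kmaj(n/k)` (`‖κ̃₀ⱼ(n/k;drk)‖ ≤ Kmaj(n/k)` by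
  `norm_kappaTilde_le_Kmaj`, `|k^{1−β_j}| = k`), a non-negative MULTIPLICATIVE function of `n`
  independent of `d, r`, with `g(p) ≤ 3 + K log p + M/p` (`K = (32.25 + 5M)B`, `M = 8S₃ + 2`) and
  `g(p^ν) ≤ (6 + 3S₃)(ν+1)⁴` at the primes `p` with `B log p ≤ 1/8`;
* `Σ_{n≤X} g(n)/n ≤ exp(12 + K log 4X + M + (6+3S₃)S₄)·(log X)³` (`XiZeroMajorant.sum_div_le_gen`);
  for `D` large, `x ≤ T = exp(𝓛^{1.1})` and `X = max(⌈x⌉, 2) ≤ 2x`: `B ≤ 9α = 9π𝓛⁻⁹`,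
  `B log 4X ≤ 36π`, `log X ≤ 1 + log x`.

No statement about the manuscript's Theorems 1–2 or about Landau–Siegel zeros is made or implied.

## References

* Y. Zhang, arXiv:2211.02515v1 (2022), §7 p. 33; §8 p. 47 (display before (8.10)).
  [cite: Zhang2022LandauSiegel, §7 p.33; §8 p.47]
* R. R. Hall, G. Tenenbaum, *Divisors* (CUP 1988), (0.4). [cite: HallTenenbaum1988, (0.4)]
-/

-- BODY --
noncomputable section

open Finset Real ArithmeticFunction

namespace Literature.NumberTheory.LFunctions.Zhang2022.XiZeroMajorant

open MeanSquareMajorant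

variable (c' : ℝ) (D : ℕ)

/-! ### Part 4. The shifts as real numbers and the bound for `λ₀ⱼ(q)` -/

/-- The real shift `b_j` behind `β_j = i b_j` with the index convention of §8
(`β₄ = β₁, β₅ = β₂`; `j` read modulo `3`). [cite: Zhang2022LandauSiegel, §2 (2.13); §8 p.46] -/
def bJ (j : ℕ) : ℝ :=
  if j % 3 = 1 then Skeleton.b1 c' D else if j % 3 = 2 then Skeleton.b2 c' D else Skeleton.b3 c' D

/-- `B = |b₁| + |b₂| + |b₃|`, the total shift size. [cite: Zhang2022LandauSiegel, §2 (2.13)] -/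
def Bsum : ℝ := |Skeleton.b1 c' D| + |Skeleton.b2 c' D| + |Skeleton.b3 c' D|

/-- `β₁ = i b₁`. [cite: Zhang2022LandauSiegel, §2 (2.13)] -/
theorem beta1_eq : Skeleton.beta1 c' D = (Skeleton.b1 c' D : ℂ) * Complex.I := by
  rw [Skeleton.beta1, Skeleton.b1]; push_cast; ring

/-- `β₂ = i b₂`. [cite: Zhang2022LandauSiegel, §2 (2.13)] -/
theorem beta2_eq : Skeleton.beta2 c' D = (Skeleton.b2 c' D : ℂ) * Complex.I := by
  rw [Skeleton.beta2, Skeleton.b2]; push_cast; ring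

/-- `β₃ = i b₃`. [cite: Zhang2022LandauSiegel, §2 (2.13)] -/
theorem beta3_eq : Skeleton.beta3 c' D = (Skeleton.b3 c' D : ℂ) * Complex.I := by
  rw [Skeleton.beta3, Skeleton.b3]; push_cast; ring

/-- `β_j = i·bJ j`. [cite: Zhang2022LandauSiegel, §8 p.46] -/
theorem betaJ_eq (j : ℕ) : Skeleton.betaJ c' D j = (bJ c' D j : ℂ) * Complex.I := by
  unfold Skeleton.betaJ bJ
  split_ifs
  · exact beta1_eq c' D
  · exact beta2_eq c' D
  · exact beta3_eq c' D

/-- `|bJ j| ≤ B`. [cite: Zhang2022LandauSiegel, §2 (2.13)] -/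
theorem abs_bJ_le (j : ℕ) : |bJ c' D j| ≤ Bsum c' D := by
  unfold bJ Bsum
  split_ifs <;> linarith [abs_nonneg (Skeleton.b1 c' D), abs_nonneg (Skeleton.b2 c' D),
    abs_nonneg (Skeleton.b3 c' D)]

/-- `0 ≤ B`. [cite: Zhang2022LandauSiegel, §2 (2.13)] -/
theorem Bsum_nonneg : 0 ≤ Bsum c' D := by unfold Bsum; positivity

/-- `Re(1 − β_j) = 1`. [cite: Zhang2022LandauSiegel, §2 (2.13)] -/
theorem one_sub_betaJ_re (j : ℕ) : (1 - Skeleton.betaJ c' D j).re = 1 := by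
  rw [betaJ_eq]; simp

/-- The perturbed Euler factor: for `q ≥ 2` and real `t`,
`‖1 − q^{−(1+it)}‖ ≤ (1 − 1/q) + |t| log q / q` and `≥ (1 − 1/q) − |t| log q / q`
(`q^{−(1+it)} = q⁻¹·q^{−it}`, `|q^{−it} − 1| ≤ |t| log q`). [cite: Zhang2022LandauSiegel, §7 p.33] -/
theorem norm_one_sub_cpow_bounds {q : ℕ} (hq : 2 ≤ q) (t : ℝ) :
    (1 - 1 / (q : ℝ)) - |t| * Real.log q / q ≤ ‖1 - (q : ℂ) ^ (-(1 + t * Complex.I))‖ ∧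
      ‖1 - (q : ℂ) ^ (-(1 + t * Complex.I))‖ ≤ (1 - 1 / (q : ℝ)) + |t| * Real.log q / q := by
  have hq0 : (q : ℂ) ≠ 0 := by exact_mod_cast (show q ≠ 0 by omega)
  have hqpos : 0 < q := by omega
  have hqr : (2 : ℝ) ≤ q := by exact_mod_cast hq
  set u : ℂ := (q : ℂ) ^ (-(t * Complex.I)) with hu
  have hsplit : (q : ℂ) ^ (-(1 + t * Complex.I)) = (q : ℂ)⁻¹ * u := by
    rw [show (-(1 + t * Complex.I) : ℂ) = (-1) + (-(t * Complex.I)) by ring,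
      Complex.cpow_add _ _ hq0, Complex.cpow_neg_one]
  have hu1 : ‖u - 1‖ ≤ |t| * Real.log q := by
    rw [hu, ← powI_apply_of_ne_zero t (show q ≠ 0 by omega)]
    exact norm_powI_sub_one_le t hqpos
  have hdecomp : 1 - (q : ℂ)⁻¹ * u = (1 - (q : ℂ)⁻¹) + (q : ℂ)⁻¹ * (1 - u) := by ring
  have hn1 : ‖(1 : ℂ) - (q : ℂ)⁻¹‖ = 1 - 1 / (q : ℝ) := by
    have : (1 : ℂ) - (q : ℂ)⁻¹ = ((1 - 1 / (q : ℝ) : ℝ) : ℂ) := by push_cast; ring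
    rw [this, Complex.norm_real, Real.norm_eq_abs, abs_of_nonneg]
    rw [sub_nonneg, div_le_one (by linarith)]; linarith
  have hn2 : ‖(q : ℂ)⁻¹ * (1 - u)‖ ≤ |t| * Real.log q / q := by
    rw [norm_mul, norm_inv, Complex.norm_natCast, norm_sub_rev, mul_comm, ← div_eq_mul_inv]
    exact div_le_div_of_nonneg_right hu1 (by linarith)
  rw [hsplit, hdecomp]
  constructor
  · have h := norm_sub_norm_le ((1 : ℂ) - (q : ℂ)⁻¹) (-((q : ℂ)⁻¹ * (1 - u)))
    rw [norm_neg, sub_neg_eq_add, hn1] at h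
    linarith
  · calc ‖(1 - (q : ℂ)⁻¹) + (q : ℂ)⁻¹ * (1 - u)‖
        ≤ ‖(1 : ℂ) - (q : ℂ)⁻¹‖ + ‖(q : ℂ)⁻¹ * (1 - u)‖ := norm_add_le _ _
      _ ≤ (1 - 1 / (q : ℝ)) + |t| * Real.log q / q := by rw [hn1]; linarith

/-- The elementary inequality behind `|λ₀ⱼ(q)| ≤ 1 + 10ε`: for `u ∈ [1/2, 1]`, `0 ≤ ε ≤ 1/8`,
`n_i ≤ u(1 + 2ε)` (`n₁, n₂ ≥ 0`) and `dd ≥ u(1 − ε)`: `n₁n₂n₃/dd ≤ 1 + 10ε`. [cite: Zhang2022LandauSiegel, §7 p.33] -/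
theorem ratio_le_of_bounds {u ε n₁ n₂ n₃ dd : ℝ} (hu : 1 / 2 ≤ u) (hu1 : u ≤ 1) (hε : 0 ≤ ε)
    (hε8 : ε ≤ 1 / 8) (h₁ : n₁ ≤ u * (1 + 2 * ε)) (h₂ : n₂ ≤ u * (1 + 2 * ε))
    (h₃ : n₃ ≤ u * (1 + 2 * ε)) (hn₁ : 0 ≤ n₁) (hn₂ : 0 ≤ n₂)
    (hdd : u * (1 - ε) ≤ dd) : n₁ * n₂ * n₃ / dd ≤ 1 + 10 * ε := by
  have hupos : 0 < u := by linarith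
  have hddpos : 0 < dd := lt_of_lt_of_le (by nlinarith) hdd
  rw [div_le_iff₀ hddpos]
  have hprod : n₁ * n₂ * n₃ ≤ (u * (1 + 2 * ε)) ^ 3 := by
    have h12 : n₁ * n₂ ≤ (u * (1 + 2 * ε)) ^ 2 := by nlinarith
    nlinarith [mul_nonneg hn₁ hn₂]
  have hkey : (1 + 2 * ε) ^ 3 ≤ (1 + 10 * ε) * (1 - ε) := by
    have h1 : 0 ≤ 3 - 22 * ε - 8 * ε ^ 2 := by nlinarith
    nlinarith [mul_nonneg hε h1]
  calc n₁ * n₂ * n₃ ≤ (u * (1 + 2 * ε)) ^ 3 := hprod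
    _ = u ^ 2 * (u * (1 + 2 * ε) ^ 3) := by ring
    _ ≤ 1 * (u * ((1 + 10 * ε) * (1 - ε))) := by
        apply mul_le_mul (by nlinarith) (mul_le_mul_of_nonneg_left hkey hupos.le)
          (by positivity) (by norm_num)
    _ = (1 + 10 * ε) * (u * (1 - ε)) := by ring
    _ ≤ (1 + 10 * ε) * dd := mul_le_mul_of_nonneg_left hdd (by positivity)

/-- **`|λ₀ⱼ(q)| ≤ 1 + 10·B log q`** for a prime `q` with `B log q ≤ 1/8` (any `j`): the three
numerator factors of `λ(q, 1−β_j) = ∏_i(1 − q^{−(1−β_j+β_i)})/(1 − q^{−(1−β_j)})` and the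
denominator are `1 − q⁻¹` up to `q⁻¹(q^{−i(b_i−b_j)} − 1)`, `|b_i − b_j| ≤ 2B`.
[cite: Zhang2022LandauSiegel, §7 p.33] -/
theorem norm_lamZero_le {q : ℕ} (hq : q.Prime) (j : ℕ)
    (hB : Bsum c' D * Real.log q ≤ 1 / 8) :
    ‖Skeleton.lamZero c' D j q‖ ≤ 1 + 10 * (Bsum c' D * Real.log q) := by
  have hq2 : 2 ≤ q := hq.two_le
  have hqr : (2 : ℝ) ≤ q := by exact_mod_cast hq2
  have hqpos : (0 : ℝ) < q := by linarith
  have hlog : 0 ≤ Real.log q := Real.log_nonneg (by linarith)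
  have hB0 := Bsum_nonneg c' D
  set ε := Bsum c' D * Real.log q with hε
  have hε0 : 0 ≤ ε := mul_nonneg hB0 hlog
  set u : ℝ := 1 - 1 / (q : ℝ) with hu_def
  have hq12 : 1 / (q : ℝ) ≤ 1 / 2 := one_div_le_one_div_of_le two_pos hqr
  have hq0' : 0 ≤ 1 / (q : ℝ) := by positivity
  have hu : 1 / 2 ≤ u := by rw [hu_def]; linarith
  have hu1 : u ≤ 1 := by rw [hu_def]; linarith
  have hqu : 1 / (q : ℝ) ≤ u := by rw [hu_def]; linarith
  -- unfold `λ₀ⱼ(q)`: one prime factor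
  rw [Skeleton.lamZero, Skeleton.lam, hq.primeFactors, prod_singleton]
  set s : ℂ := 1 - Skeleton.betaJ c' D j with hs
  -- the exponents as `-(1 + t I)`
  have hexp : ∀ b : ℝ, -(s + (b : ℂ) * Complex.I) =
      -(1 + ((b - bJ c' D j : ℝ) : ℂ) * Complex.I) := by
    intro b; rw [hs, betaJ_eq]; push_cast; ring
  have hexp0 : -s = -(1 + ((-bJ c' D j : ℝ) : ℂ) * Complex.I) := by
    rw [hs, betaJ_eq]; push_cast; ring
  rw [beta1_eq, beta2_eq, beta3_eq, hexp, hexp, hexp, hexp0]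
  -- bounds on each factor
  have hbj := abs_bJ_le c' D j
  have htb : ∀ b : ℝ, |b| ≤ Bsum c' D → |b - bJ c' D j| * Real.log q ≤ 2 * ε := by
    intro b hb
    have : |b - bJ c' D j| ≤ 2 * Bsum c' D := by
      calc |b - bJ c' D j| ≤ |b| + |bJ c' D j| := abs_sub _ _
        _ ≤ 2 * Bsum c' D := by linarith
    calc |b - bJ c' D j| * Real.log q ≤ 2 * Bsum c' D * Real.log q :=
        mul_le_mul_of_nonneg_right this hlog
      _ = 2 * ε := by rw [hε]; ring
  have hb1 : |Skeleton.b1 c' D| ≤ Bsum c' D := by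
    unfold Bsum; linarith [abs_nonneg (Skeleton.b2 c' D), abs_nonneg (Skeleton.b3 c' D)]
  have hb2 : |Skeleton.b2 c' D| ≤ Bsum c' D := by
    unfold Bsum; linarith [abs_nonneg (Skeleton.b1 c' D), abs_nonneg (Skeleton.b3 c' D)]
  have hb3 : |Skeleton.b3 c' D| ≤ Bsum c' D := by
    unfold Bsum; linarith [abs_nonneg (Skeleton.b1 c' D), abs_nonneg (Skeleton.b2 c' D)]
  have hN : ∀ b : ℝ, |b| ≤ Bsum c' D →
      ‖1 - (q : ℂ) ^ (-(1 + ((b - bJ c' D j : ℝ) : ℂ) * Complex.I))‖ ≤ u * (1 + 2 * ε) := by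
    intro b hb
    have h := (norm_one_sub_cpow_bounds hq2 (b - bJ c' D j)).2
    have h2 : |b - bJ c' D j| * Real.log q / q ≤ 2 * ε * u := by
      calc |b - bJ c' D j| * Real.log q / q = |b - bJ c' D j| * Real.log q * (1 / q) := by ring
        _ ≤ (2 * ε) * u := mul_le_mul (htb b hb) hqu (by positivity) (by positivity)
        _ = 2 * ε * u := by ring
    calc _ ≤ (1 - 1 / (q : ℝ)) + |b - bJ c' D j| * Real.log q / q := h
      _ ≤ u + 2 * ε * u := by rw [← hu_def]; linarith
      _ = u * (1 + 2 * ε) := by ring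
  have hDen : u * (1 - ε) ≤ ‖1 - (q : ℂ) ^ (-(1 + ((-bJ c' D j : ℝ) : ℂ) * Complex.I))‖ := by
    have h := (norm_one_sub_cpow_bounds hq2 (-bJ c' D j)).1
    have h2 : |(-bJ c' D j)| * Real.log q / q ≤ ε * u := by
      rw [abs_neg]
      calc |bJ c' D j| * Real.log q / q = |bJ c' D j| * Real.log q * (1 / q) := by ring
        _ ≤ ε * u := by
            apply mul_le_mul _ hqu (by positivity) hε0
            calc |bJ c' D j| * Real.log q ≤ Bsum c' D * Real.log q :=
                mul_le_mul_of_nonneg_right hbj hlog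
              _ = ε := hε.symm
    calc u * (1 - ε) = u - ε * u := by ring
      _ ≤ (1 - 1 / (q : ℝ)) - |(-bJ c' D j)| * Real.log q / q := by rw [← hu_def]; linarith
      _ ≤ _ := h
  rw [norm_div, norm_mul, norm_mul]
  exact ratio_le_of_bounds hu hu1 hε0 hB (hN _ hb1) (hN _ hb2) (hN _ hb3) (norm_nonneg _)
    (norm_nonneg _) hDen

/-! ### Part 5. The multiplicative majorant `g` of `ξ₀ⱼ` -/

/-- `Λ(n) = ∏_{q∣n}(1 + 10B log q)` (`0 ↦ 0`), the majorant of `λ̃₀ⱼ(n,·)`.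
[cite: Zhang2022LandauSiegel, §7 p.33] -/
def LamA : ArithmeticFunction ℝ :=
  ⟨fun n => if n = 0 then 0 else ∏ q ∈ n.primeFactors, (1 + 10 * (Bsum c' D * Real.log q)),
    if_pos rfl⟩

/-- `w(k) = |μ(k)|·k/φ(k)`, the weight of the `k`-sum of `ξ₀ⱼ`. [cite: Zhang2022LandauSiegel, §7 p.33] -/
def Wt : ArithmeticFunction ℝ :=
  ⟨fun k => ((ArithmeticFunction.moebius k).natAbs : ℝ) * k / Nat.totient k, by simp⟩

/-- `Kmaj` as an arithmetic function (`0 ↦ 0`). [cite: Zhang2022LandauSiegel, §7 p.33] -/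
def KA : ArithmeticFunction ℝ := ⟨fun n => if n = 0 then 0 else Kmaj c' D n, if_pos rfl⟩

/-- **The majorant `g = Λ · (w ∗ Kmaj)`** of `|ξ₀ⱼ(·;d,r)|` (independent of `d, r, j`).
[cite: Zhang2022LandauSiegel, §7 p.33] -/
def gMaj : ArithmeticFunction ℝ := (LamA c' D).pmul (Wt * KA c' D)

/-- `Λ(n)` for `n ≠ 0`. [cite: Zhang2022LandauSiegel, §7 p.33] -/
theorem LamA_apply {n : ℕ} (hn : n ≠ 0) :
    LamA c' D n = ∏ q ∈ n.primeFactors, (1 + 10 * (Bsum c' D * Real.log q)) := by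
  rw [LamA]; exact if_neg hn

/-- Each factor `1 + 10B log q ≥ 1` (`q ≥ 1`). [cite: Zhang2022LandauSiegel, §7 p.33] -/
theorem one_le_LamA_factor {q : ℕ} (hq : q.Prime) : 1 ≤ 1 + 10 * (Bsum c' D * Real.log q) := by
  have : 0 ≤ Real.log q := Real.log_nonneg (by exact_mod_cast hq.one_lt.le)
  nlinarith [Bsum_nonneg c' D]

/-- `Λ` is multiplicative. [cite: Zhang2022LandauSiegel, §7 p.33] -/
theorem isMultiplicative_LamA : (LamA c' D).IsMultiplicative := by
  rw [IsMultiplicative.iff_ne_zero]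
  refine ⟨by simp [LamA], fun {m n} hm hn hmn => ?_⟩
  rw [LamA_apply c' D (mul_ne_zero hm hn), LamA_apply c' D hm, LamA_apply c' D hn,
    Nat.primeFactors_mul hm hn, prod_union (Nat.Coprime.disjoint_primeFactors hmn)]

/-- `0 ≤ Λ(n)`. [cite: Zhang2022LandauSiegel, §7 p.33] -/
theorem LamA_nonneg (n : ℕ) : 0 ≤ LamA c' D n := by
  rcases eq_or_ne n 0 with rfl | hn
  · simp [LamA]
  · rw [LamA_apply c' D hn]
    exact prod_nonneg fun q hq => by
      linarith [one_le_LamA_factor c' D (Nat.prime_of_mem_primeFactors hq)]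

/-- `w(k)` unfolded. [cite: Zhang2022LandauSiegel, §7 p.33] -/
theorem Wt_apply (k : ℕ) :
    Wt k = ((ArithmeticFunction.moebius k).natAbs : ℝ) * k / Nat.totient k := rfl

/-- `0 ≤ w(k)`. [cite: Zhang2022LandauSiegel, §7 p.33] -/
theorem Wt_nonneg (k : ℕ) : 0 ≤ Wt k := by rw [Wt_apply]; positivity

/-- `w` is multiplicative (`|μ|`, `id`, `φ` are). [cite: Zhang2022LandauSiegel, §7 p.33] -/
theorem isMultiplicative_Wt : Wt.IsMultiplicative := by
  refine ⟨by simp [Wt_apply], fun {m n} hmn => ?_⟩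
  rw [Wt_apply, Wt_apply, Wt_apply, isMultiplicative_moebius.map_mul_of_coprime hmn,
    Int.natAbs_mul, Nat.totient_mul hmn]
  push_cast
  rw [div_mul_div_comm]; ring

/-- `KA n = Kmaj n` for `n ≠ 0`. [cite: Zhang2022LandauSiegel, §7 p.33] -/
theorem KA_apply {n : ℕ} (hn : n ≠ 0) : KA c' D n = Kmaj c' D n := by
  rw [KA]; exact if_neg hn

/-- `KA` is multiplicative. [cite: Zhang2022LandauSiegel, §7 p.33] -/
theorem isMultiplicative_KA : (KA c' D).IsMultiplicative := by
  rw [IsMultiplicative.iff_ne_zero]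
  refine ⟨by rw [KA_apply c' D one_ne_zero, Kmaj_one], fun {m n} hm hn hmn => ?_⟩
  rw [KA_apply c' D (mul_ne_zero hm hn), KA_apply c' D hm, KA_apply c' D hn,
    Kmaj_mul_of_coprime c' D hmn]

/-- `0 ≤ KA n`. [cite: Zhang2022LandauSiegel, §7 p.33] -/
theorem KA_nonneg (n : ℕ) : 0 ≤ KA c' D n := by
  rcases eq_or_ne n 0 with rfl | hn
  · simp [KA]
  · rw [KA_apply c' D hn]; exact Kmaj_nonneg c' D n

/-- `g` is multiplicative. [cite: Zhang2022LandauSiegel, §7 p.33] -/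
theorem isMultiplicative_gMaj : (gMaj c' D).IsMultiplicative :=
  (isMultiplicative_LamA c' D).pmul (isMultiplicative_Wt.mul (isMultiplicative_KA c' D))

/-- `(w ∗ Kmaj)(n) = Σ_{k∣n} w(k)Kmaj(n/k)` and it is `≥ 0`. [cite: Zhang2022LandauSiegel, §7 p.33] -/
theorem WK_apply (n : ℕ) :
    (Wt * KA c' D) n = ∑ k ∈ n.divisors, Wt k * KA c' D (n / k) := by
  rw [mul_apply, Nat.sum_divisorsAntidiagonal fun a b => Wt a * KA c' D b]

/-- `0 ≤ (w ∗ Kmaj)(n)`. [cite: Zhang2022LandauSiegel, §7 p.33] -/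
theorem WK_nonneg (n : ℕ) : 0 ≤ (Wt * KA c' D) n := by
  rw [WK_apply]; exact sum_nonneg fun k _ => mul_nonneg (Wt_nonneg k) (KA_nonneg c' D _)

/-- `0 ≤ g(n)`. [cite: Zhang2022LandauSiegel, §7 p.33] -/
theorem gMaj_nonneg (n : ℕ) : 0 ≤ gMaj c' D n := by
  rw [gMaj, pmul_apply]; exact mul_nonneg (LamA_nonneg c' D n) (WK_nonneg c' D n)

/-! ### Part 6. `|ξ₀ⱼ(n;d,r)| ≤ g(n)` -/

/-- **`|λ̃₀ⱼ(n,dr)| ≤ Λ(n)`** when `B log q ≤ 1/8` for the primes `q ∣ n` (`n ≠ 0`).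
[cite: Zhang2022LandauSiegel, §7 p.33] -/
theorem norm_lamTildeZero_le {n : ℕ} (hn : n ≠ 0) (j dr : ℕ)
    (hB : ∀ q ∈ n.primeFactors, Bsum c' D * Real.log q ≤ 1 / 8) :
    ‖Skeleton.lamTildeZero c' D j n dr‖ ≤ LamA c' D n := by
  classical
  have hS : n.primeFactors.filter (fun q => Nat.Coprime q dr) ⊆ n.primeFactors :=
    filter_subset _ _
  rw [Skeleton.lamTildeZero, norm_prod, LamA_apply c' D hn, ← prod_sdiff hS]
  set S := n.primeFactors.filter (fun q => Nat.Coprime q dr) with hSdef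
  have h1 : ∏ q ∈ S, ‖Skeleton.lamZero c' D j q‖ ≤
      ∏ q ∈ S, (1 + 10 * (Bsum c' D * Real.log q)) :=
    prod_le_prod (fun q _ => norm_nonneg _) fun q hq =>
      norm_lamZero_le c' D (Nat.prime_of_mem_primeFactors (hS hq)) j (hB q (hS hq))
  have hge1 : (1 : ℝ) ≤ ∏ q ∈ (n.primeFactors \ S), (1 + 10 * (Bsum c' D * Real.log q)) := by
    calc (1 : ℝ) = ∏ q ∈ (n.primeFactors \ S), (1 : ℝ) := by simp
      _ ≤ _ := prod_le_prod (fun _ _ => zero_le_one) fun q hq =>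
          one_le_LamA_factor c' D (Nat.prime_of_mem_primeFactors (mem_sdiff.mp hq).1)
  have hnn : 0 ≤ ∏ q ∈ S, (1 + 10 * (Bsum c' D * Real.log q)) :=
    prod_nonneg fun q hq => by
      linarith [one_le_LamA_factor c' D (Nat.prime_of_mem_primeFactors (hS hq))]
  exact h1.trans (le_mul_of_one_le_left hnn hge1)

/-- One term of the `k`-sum: for `k ∣ n` (`n ≠ 0`),
`‖κ̃₀ⱼ(n/k;drk)μ(k)k^{1−β_j}/φ(k)‖ ≤ w(k)·Kmaj(n/k)`. [cite: Zhang2022LandauSiegel, §7 p.33] -/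
theorem norm_xiZero_term_le {n : ℕ} (hn : n ≠ 0) (j d r : ℕ) {k : ℕ} (hk : k ∈ n.divisors) :
    ‖Skeleton.kappaTildeZero c' D j (n / k) (d * r * k) * (ArithmeticFunction.moebius k : ℂ) *
        (k : ℂ) ^ (1 - Skeleton.betaJ c' D j) / (Nat.totient k : ℂ)‖ ≤
      Wt k * KA c' D (n / k) := by
  have hkn := Nat.dvd_of_mem_divisors hk
  have hk0 : k ≠ 0 := Nat.ne_of_gt (Nat.pos_of_mem_divisors hk)
  have hkpos : 0 < k := Nat.pos_of_ne_zero hk0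
  have hnk : n / k ≠ 0 := (Nat.div_ne_zero_iff_of_dvd hkn).mpr ⟨hn, hk0⟩
  have h1 : ‖Skeleton.kappaTildeZero c' D j (n / k) (d * r * k)‖ ≤ Kmaj c' D (n / k) := by
    rw [Skeleton.kappaTildeZero]
    exact norm_kappaTilde_le_Kmaj c' D hnk _ (one_sub_betaJ_re c' D j)
  have h2 : ‖(ArithmeticFunction.moebius k : ℂ)‖ = ((ArithmeticFunction.moebius k).natAbs : ℝ) := by
    rw [Complex.norm_intCast, Nat.cast_natAbs, Int.cast_abs]
  have h3 : ‖(k : ℂ) ^ (1 - Skeleton.betaJ c' D j)‖ = k := by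
    rw [Complex.norm_natCast_cpow_of_pos hkpos, one_sub_betaJ_re, Real.rpow_one]
  have h4 : ‖(Nat.totient k : ℂ)‖ = Nat.totient k := Complex.norm_natCast _
  rw [norm_div, norm_mul, norm_mul, h2, h3, h4, KA_apply c' D hnk, Wt_apply]
  have hw : 0 ≤ ((ArithmeticFunction.moebius k).natAbs : ℝ) * k / Nat.totient k := by positivity
  calc ‖Skeleton.kappaTildeZero c' D j (n / k) (d * r * k)‖ *
        ((ArithmeticFunction.moebius k).natAbs : ℝ) * k / Nat.totient k
      = ‖Skeleton.kappaTildeZero c' D j (n / k) (d * r * k)‖ *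
        (((ArithmeticFunction.moebius k).natAbs : ℝ) * k / Nat.totient k) := by ring
    _ ≤ Kmaj c' D (n / k) * (((ArithmeticFunction.moebius k).natAbs : ℝ) * k / Nat.totient k) :=
        mul_le_mul_of_nonneg_right h1 hw
    _ = _ := by ring

/-- **`|ξ₀ⱼ(n;d,r)| ≤ g(n)`** for `n ≠ 0` with `B log q ≤ 1/8` at the primes `q ∣ n` (any `j, d, r`).
[cite: Zhang2022LandauSiegel, §7 p.33] -/
theorem norm_xiZero_le_gMaj {n : ℕ} (hn : n ≠ 0) (j d r : ℕ)
    (hB : ∀ q ∈ n.primeFactors, Bsum c' D * Real.log q ≤ 1 / 8) :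
    ‖Skeleton.xiZero c' D j n d r‖ ≤ gMaj c' D n := by
  rw [Skeleton.xiZero, norm_mul, gMaj, pmul_apply, WK_apply]
  refine mul_le_mul (norm_lamTildeZero_le c' D hn j (d * r) hB) ?_ (norm_nonneg _)
    (LamA_nonneg c' D n)
  calc ‖∑ k ∈ n.divisors.filter (fun k => Nat.Coprime k r),
          Skeleton.kappaTildeZero c' D j (n / k) (d * r * k) * (ArithmeticFunction.moebius k : ℂ) *
            (k : ℂ) ^ (1 - Skeleton.betaJ c' D j) / (Nat.totient k : ℂ)‖
      ≤ ∑ k ∈ n.divisors.filter (fun k => Nat.Coprime k r),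
          ‖Skeleton.kappaTildeZero c' D j (n / k) (d * r * k) * (ArithmeticFunction.moebius k : ℂ) *
            (k : ℂ) ^ (1 - Skeleton.betaJ c' D j) / (Nat.totient k : ℂ)‖ := norm_sum_le _ _
    _ ≤ ∑ k ∈ n.divisors.filter (fun k => Nat.Coprime k r), Wt k * KA c' D (n / k) :=
        sum_le_sum fun k hk => norm_xiZero_term_le c' D hn j d r (mem_filter.mp hk).1
    _ ≤ ∑ k ∈ n.divisors, Wt k * KA c' D (n / k) :=
        sum_le_sum_of_subset_of_nonneg (filter_subset _ _)
          fun k _ _ => mul_nonneg (Wt_nonneg k) (KA_nonneg c' D _)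

/-! ### Part 7. The values of `g` at primes and prime powers -/

/-- `M₀ = 8S₃ + 2`, the `1/p`-coefficient at the primes (`S₃ = LogEulerProduct.tailConst 3`).
[cite: Zhang2022LandauSiegel, §7 p.33] -/
def M0 : ℝ := 8 * LogEulerProduct.tailConst 3 + 2

/-- `C₅ = 6 + 3S₃`, the prime-power constant. [cite: Zhang2022LandauSiegel, §7 p.33] -/
def C5 : ℝ := 6 + 3 * LogEulerProduct.tailConst 3

/-- `0 ≤ M₀`. [cite: Zhang2022LandauSiegel, §7 p.33] -/
theorem M0_nonneg : 0 ≤ M0 := by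
  unfold M0; linarith [LogEulerProduct.tailConst_nonneg 3]

/-- `0 ≤ C₅`. [cite: Zhang2022LandauSiegel, §7 p.33] -/
theorem C5_nonneg : 0 ≤ C5 := by
  unfold C5; linarith [LogEulerProduct.tailConst_nonneg 3]

/-- `w(p^i) ≤ 2` at prime powers (`w(1) = 1`, `w(p) = p/(p−1) ≤ 2`, `w(p^i) = 0` for `i ≥ 2`).
[cite: Zhang2022LandauSiegel, §7 p.33] -/
theorem Wt_prime_pow_le {p : ℕ} (hp : p.Prime) (i : ℕ) : Wt (p ^ i) ≤ 2 := by
  have hp2 : (2 : ℝ) ≤ p := by exact_mod_cast hp.two_le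
  rcases Nat.eq_zero_or_pos i with rfl | hi
  · simp [Wt_apply]
  rw [Wt_apply, ArithmeticFunction.moebius_apply_prime_pow hp hi.ne', Nat.totient_prime_pow hp hi]
  split_ifs with h1
  · subst h1
    simp only [Int.reduceNeg, Int.natAbs_neg, Int.natAbs_one, Nat.cast_one, one_mul, pow_one,
      Nat.sub_self, pow_zero]
    push_cast [Nat.cast_sub hp.one_le]
    rw [div_le_iff₀ (by linarith)]
    linarith
  · simp

/-- `Kmaj(p^m) ≤ (m+1)³(1 + S₃/2)` at prime powers (`m ≥ 0`, with `Kmaj 1 = 1`).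
[cite: Zhang2022LandauSiegel, §7 p.33] -/
theorem KA_prime_pow_le {p : ℕ} (hp : p.Prime) (m : ℕ) :
    KA c' D (p ^ m) ≤ ((m : ℝ) + 1) ^ 3 * (1 + LogEulerProduct.tailConst 3 / 2) := by
  have hT := LogEulerProduct.tailConst_nonneg 3
  have hp2 : (2 : ℝ) ≤ p := by exact_mod_cast hp.two_le
  rcases Nat.eq_zero_or_pos m with rfl | hm
  · rw [pow_zero, KA_apply c' D one_ne_zero, Kmaj_one]
    simp only [CharP.cast_eq_zero, zero_add, one_pow, one_mul]
    linarith [div_nonneg hT zero_le_two]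
  rw [KA_apply c' D (pow_ne_zero m hp.ne_zero), Kmaj_prime_pow c' D hp hm.ne']
  refine (locK_le c' D hp m).trans ?_
  have h1 : ‖Skeleton.kappaZ c' D (p ^ m)‖ ≤ ((m : ℝ) + 1) ^ 3 :=
    norm_kappa_prime_pow_le _ _ _ hp m
  have h2 : ((m : ℝ) + 1) ^ 3 * LogEulerProduct.tailConst 3 / p ≤
      ((m : ℝ) + 1) ^ 3 * LogEulerProduct.tailConst 3 / 2 :=
    div_le_div_of_nonneg_left (by positivity) two_pos hp2
  nlinarith

/-- `(w ∗ Kmaj)(p^ν) ≤ (2 + S₃)(ν+1)⁴` at prime powers. [cite: Zhang2022LandauSiegel, §7 p.33] -/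
theorem WK_prime_pow_le {p : ℕ} (hp : p.Prime) (ν : ℕ) :
    (Wt * KA c' D) (p ^ ν) ≤ (2 + LogEulerProduct.tailConst 3) * ((ν : ℝ) + 1) ^ 4 := by
  have hT := LogEulerProduct.tailConst_nonneg 3
  rw [RankinEisenstein.mul_apply_prime_pow Wt (KA c' D) hp ν]
  have hterm : ∀ i ∈ range (ν + 1), Wt (p ^ i) * KA c' D (p ^ (ν - i)) ≤
      2 * (((ν : ℝ) + 1) ^ 3 * (1 + LogEulerProduct.tailConst 3 / 2)) := by
    intro i hi
    have hiν : ((ν - i : ℕ) : ℝ) + 1 ≤ (ν : ℝ) + 1 := by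
      have : ν - i ≤ ν := Nat.sub_le ν i
      exact_mod_cast Nat.add_le_add_right this 1
    calc Wt (p ^ i) * KA c' D (p ^ (ν - i))
        ≤ 2 * ((((ν - i : ℕ) : ℝ) + 1) ^ 3 * (1 + LogEulerProduct.tailConst 3 / 2)) :=
          mul_le_mul (Wt_prime_pow_le hp i) (KA_prime_pow_le c' D hp _) (KA_nonneg c' D _)
            zero_le_two
      _ ≤ 2 * (((ν : ℝ) + 1) ^ 3 * (1 + LogEulerProduct.tailConst 3 / 2)) := by
          gcongr
  calc ∑ i ∈ range (ν + 1), Wt (p ^ i) * KA c' D (p ^ (ν - i))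
      ≤ ∑ i ∈ range (ν + 1), 2 * (((ν : ℝ) + 1) ^ 3 * (1 + LogEulerProduct.tailConst 3 / 2)) :=
        sum_le_sum hterm
    _ = ((ν : ℝ) + 1) * (2 * (((ν : ℝ) + 1) ^ 3 * (1 + LogEulerProduct.tailConst 3 / 2))) := by
        rw [sum_const, card_range, nsmul_eq_mul]; push_cast; ring
    _ = (2 + LogEulerProduct.tailConst 3) * ((ν : ℝ) + 1) ^ 4 := by ring

/-- The local series of `g` converges at every prime. [cite: Zhang2022LandauSiegel, §7 p.33] -/
theorem summable_gMaj_local {p : ℕ} (hp : p.Prime) :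
    Summable fun ν : ℕ => gMaj c' D (p ^ ν) / (p : ℝ) ^ ν := by
  have hT := LogEulerProduct.tailConst_nonneg 3
  have hp2 : (2 : ℝ) ≤ p := by exact_mod_cast hp.two_le
  set L : ℝ := 1 + 10 * (Bsum c' D * Real.log p) with hL
  have hL1 : 1 ≤ L := one_le_LamA_factor c' D hp
  have hLam : ∀ ν : ℕ, LamA c' D (p ^ ν) ≤ L := by
    intro ν
    rcases Nat.eq_zero_or_pos ν with rfl | hν
    · rw [pow_zero, (isMultiplicative_LamA c' D).map_one]; exact hL1
    · rw [LamA_apply c' D (pow_ne_zero ν hp.ne_zero), Nat.primeFactors_prime_pow hν.ne' hp,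
        prod_singleton]
  have hbound : ∀ ν : ℕ, gMaj c' D (p ^ ν) / (p : ℝ) ^ ν ≤
      L * (2 + LogEulerProduct.tailConst 3) * (((ν : ℝ) + 3) ^ 4 * (1 / 2 : ℝ) ^ ν) := by
    intro ν
    have hppos : (0 : ℝ) < (p : ℝ) ^ ν := by positivity
    rw [div_le_iff₀ hppos, gMaj, pmul_apply]
    have h1 : (1 : ℝ) ≤ (1 / 2 : ℝ) ^ ν * (p : ℝ) ^ ν := by
      rw [← mul_pow]; exact one_le_pow₀ (by linarith)
    have h3 : ((ν : ℝ) + 1) ^ 4 ≤ ((ν : ℝ) + 3) ^ 4 :=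
      pow_le_pow_left₀ (by positivity) (by linarith) 4
    calc LamA c' D (p ^ ν) * (Wt * KA c' D) (p ^ ν)
        ≤ L * ((2 + LogEulerProduct.tailConst 3) * ((ν : ℝ) + 1) ^ 4) :=
          mul_le_mul (hLam ν) (WK_prime_pow_le c' D hp ν) (WK_nonneg c' D _) (by linarith)
      _ ≤ L * ((2 + LogEulerProduct.tailConst 3) * ((ν : ℝ) + 3) ^ 4) := by gcongr
      _ ≤ L * ((2 + LogEulerProduct.tailConst 3) * ((ν : ℝ) + 3) ^ 4) *
            ((1 / 2 : ℝ) ^ ν * (p : ℝ) ^ ν) := le_mul_of_one_le_right (by positivity) h1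
      _ = _ := by ring
  refine Summable.of_nonneg_of_le (fun ν => div_nonneg (gMaj_nonneg c' D _) (by positivity))
    hbound ((LogEulerProduct.summable_tailConst 4).mul_left _)

/-- **`g(p) ≤ 3 + (129/4 + 5M₀)·(B log p) + M₀/p`** for a prime `p` with `B log p ≤ 1/8`:
`g(p) = (1 + 10B log p)(p/(p−1) + Kmaj p)`, `Kmaj p ≤ |κ(p)| + 8S₃/p ≤ 2 + B log p + 8S₃/p`,
`p/(p−1) ≤ 1 + 2/p`. [cite: Zhang2022LandauSiegel, §7 p.33] -/
theorem gMaj_prime_le {p : ℕ} (hp : p.Prime) (hB : Bsum c' D * Real.log p ≤ 1 / 8) :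
    gMaj c' D p ≤ 3 + (129 / 4 + 5 * M0) * (Bsum c' D * Real.log p) + M0 / p := by
  have hT := LogEulerProduct.tailConst_nonneg 3
  have hp2 : (2 : ℝ) ≤ p := by exact_mod_cast hp.two_le
  have hppos : (0 : ℝ) < p := by linarith
  have hlog : 0 ≤ Real.log p := Real.log_nonneg (by linarith)
  set ε := Bsum c' D * Real.log p with hε
  have hε0 : 0 ≤ ε := mul_nonneg (Bsum_nonneg c' D) hlog
  -- `g(p) = Λ(p)·(w(p) + Kmaj p)`
  have hLam : LamA c' D p = 1 + 10 * ε := by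
    rw [LamA_apply c' D hp.ne_zero, hp.primeFactors, prod_singleton]
  have hWK : (Wt * KA c' D) p = Wt p + KA c' D p :=
    mul_apply_prime isMultiplicative_Wt.map_one (isMultiplicative_KA c' D).map_one hp
  -- `w(p) = p/(p-1) ≤ 1 + 2/p`
  have hW : Wt p ≤ 1 + 2 / p := by
    rw [Wt_apply, ArithmeticFunction.moebius_apply_prime hp, Nat.totient_prime hp]
    simp only [Int.reduceNeg, Int.natAbs_neg, Int.natAbs_one, Nat.cast_one, one_mul]
    push_cast [Nat.cast_sub hp.one_le]
    have hp1 : (0 : ℝ) < (p : ℝ) - 1 := by linarith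
    have e1 : 1 + 1 / ((p : ℝ) - 1) = p / (p - 1) := by
      rw [add_div' _ _ _ hp1.ne']; congr 1; ring
    have e2 : 1 / ((p : ℝ) - 1) ≤ 2 / p := by
      rw [div_le_div_iff₀ hp1 hppos]; linarith
    linarith
  -- `Kmaj p ≤ 2 + ε + 8 S₃/p`
  have hK : KA c' D p ≤ 2 + ε + 8 * LogEulerProduct.tailConst 3 / p := by
    rw [KA_apply c' D hp.ne_zero]
    have h := Kmaj_prime_pow c' D hp one_ne_zero
    rw [pow_one] at h
    rw [h]
    refine (locK_le c' D hp 1).trans ?_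
    rw [pow_one]
    have hκ : ‖Skeleton.kappaZ c' D p‖ ≤ 2 + ε := by
      rw [hε, Bsum, Skeleton.kappaZ]; exact norm_kappa_prime_le _ _ _ hp
    have : (((1 : ℕ) : ℝ) + 1) ^ 3 * LogEulerProduct.tailConst 3 / p =
        8 * LogEulerProduct.tailConst 3 / p := by norm_num
    rw [this]; linarith
  rw [gMaj, pmul_apply, hLam, hWK]
  have hsum : Wt p + KA c' D p ≤ 3 + ε + M0 / p := by
    have : M0 / p = 2 / p + 8 * LogEulerProduct.tailConst 3 / p := by rw [M0]; ring
    rw [this]; linarith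
  have hsum0 : 0 ≤ Wt p + KA c' D p := add_nonneg (Wt_nonneg p) (KA_nonneg c' D p)
  have hMp : M0 / p ≤ M0 / 2 := div_le_div_of_nonneg_left M0_nonneg two_pos hp2
  calc (1 + 10 * ε) * (Wt p + KA c' D p) ≤ (1 + 10 * ε) * (3 + ε + M0 / p) :=
        mul_le_mul_of_nonneg_left hsum (by positivity)
    _ = 3 + ε + M0 / p + 10 * ε * (3 + ε + M0 / p) := by ring
    _ ≤ 3 + ε + M0 / p + 10 * ε * (3 + 1 / 8 + M0 / 2) := by gcongr
    _ = 3 + (129 / 4 + 5 * M0) * ε + M0 / p := by ring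

/-- **`g(p^ν) ≤ C₅(ν+1)⁴`** for a prime `p` with `B log p ≤ 1/8` (`Λ(p^ν) ≤ 9/4 ≤ 3`).
[cite: Zhang2022LandauSiegel, §7 p.33] -/
theorem gMaj_prime_pow_le {p : ℕ} (hp : p.Prime) (hB : Bsum c' D * Real.log p ≤ 1 / 8) (ν : ℕ) :
    gMaj c' D (p ^ ν) ≤ C5 * ((ν : ℝ) + 1) ^ 4 := by
  have hT := LogEulerProduct.tailConst_nonneg 3
  have hLam : LamA c' D (p ^ ν) ≤ 3 := by
    rcases Nat.eq_zero_or_pos ν with rfl | hν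
    · rw [pow_zero, (isMultiplicative_LamA c' D).map_one]; norm_num
    · rw [LamA_apply c' D (pow_ne_zero ν hp.ne_zero), Nat.primeFactors_prime_pow hν.ne' hp,
        prod_singleton]
      linarith
  rw [gMaj, pmul_apply, C5]
  calc LamA c' D (p ^ ν) * (Wt * KA c' D) (p ^ ν)
      ≤ 3 * ((2 + LogEulerProduct.tailConst 3) * ((ν : ℝ) + 1) ^ 4) :=
        mul_le_mul hLam (WK_prime_pow_le c' D hp ν) (WK_nonneg c' D _) (by norm_num)
    _ = (6 + 3 * LogEulerProduct.tailConst 3) * ((ν : ℝ) + 1) ^ 4 := by ring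

/-- **The logarithmic mean of the majorant**: for `X ≥ 2` such that `B log p ≤ 1/8` for all primes
`p ≤ X`, `Σ_{n≤X} g(n)/n ≤ exp(12 + (129/4 + 5M₀)B·log(4X) + M₀ + C₅S₄)·(log X)³`.
[cite: HallTenenbaum1988, (0.4)] -/
theorem sum_gMaj_div_le {X : ℕ} (hX : 2 ≤ X)
    (hB : ∀ p, p.Prime → p ≤ X → Bsum c' D * Real.log p ≤ 1 / 8) :
    ∑ n ∈ Icc 1 X, gMaj c' D n / n ≤
      Real.exp (4 * (3 : ℕ) + (129 / 4 + 5 * M0) * Bsum c' D * Real.log (4 * X) + M0 +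
        C5 * LogEulerProduct.tailConst 4) * Real.log X ^ (3 : ℕ) := by
  have hg := isMultiplicative_gMaj c' D
  refine sum_div_le_gen (f := fun n => gMaj c' D n) hg.map_one
    (fun m n hmn => hg.map_mul_of_coprime hmn) (gMaj_nonneg c' D)
    (mul_nonneg (by linarith [M0_nonneg]) (Bsum_nonneg c' D)) M0_nonneg C5_nonneg hX
    (fun p hp => summable_gMaj_local c' D hp) (fun p hp hpX => ?_) (fun p ν hp hpX => ?_)
  · have h := gMaj_prime_le c' D hp (hB p hp hpX)
    push_cast
    linarith [h]
  · exact gMaj_prime_pow_le c' D hp (hB p hp hpX) ν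

/-! ### Part 8. The bookkeeping in `D` and the theorem -/

/-- For `D ≥ ⌈exp(5|c′|π + 3)⌉`: `𝓛 ≥ 3` and `B = |b₁|+|b₂|+|b₃| ≤ 9α = 9π𝓛⁻⁹`
(`|b₁| ≤ 2α`, `|b₂| ≤ 3α`, `|b₃| ≤ 4α` once `5|c′|α𝓛 ≤ 1`). [cite: Zhang2022LandauSiegel, §2 (2.13)] -/
theorem three_le_ell_and_Bsum_le {c' : ℝ} {D : ℕ} (hD : ⌈Real.exp (5 * |c'| * π + 3)⌉₊ ≤ D) :
    3 ≤ Skeleton.ell D ∧ Bsum c' D ≤ 9 * π / Skeleton.ell D ^ 9 := by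
  have hexp : Real.exp (5 * |c'| * π + 3) ≤ D := le_trans (Nat.le_ceil _) (by exact_mod_cast hD)
  have hlog : 5 * |c'| * π + 3 ≤ Real.log D :=
    (Real.le_log_iff_exp_le (lt_of_lt_of_le (Real.exp_pos _) hexp)).mpr hexp
  have hπ0 : 0 ≤ 5 * |c'| * π := by positivity
  have hL3 : 3 ≤ Skeleton.ell D := by rw [Skeleton.ell]; linarith
  have hL1 : 1 ≤ Skeleton.ell D := by linarith
  have hLpos : 0 < Skeleton.ell D := by linarith
  have hα : Skeleton.alpha D = π / Skeleton.ell D ^ 9 := by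
    rw [Skeleton.alpha, Skeleton.bigP, Real.log_exp]
  have hαpos : 0 < Skeleton.alpha D := by rw [hα]; positivity
  have hL8 : Skeleton.ell D ≤ Skeleton.ell D ^ 8 := by
    calc Skeleton.ell D = Skeleton.ell D ^ 1 := (pow_one _).symm
      _ ≤ Skeleton.ell D ^ 8 := pow_le_pow_right₀ hL1 (by norm_num)
  have h1 : 5 * |c'| * π ≤ Skeleton.ell D ^ 8 := by rw [Skeleton.ell] at hL8 ⊢; linarith
  have hpos8 : 0 < Skeleton.ell D ^ 8 := by positivity
  have hc : 5 * |c'| * Skeleton.alpha D * Skeleton.ell D ≤ 1 := by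
    calc 5 * |c'| * Skeleton.alpha D * Skeleton.ell D = 5 * |c'| * π / Skeleton.ell D ^ 8 := by
          rw [hα]; field_simp
      _ ≤ 1 := (div_le_one hpos8).mpr h1
  have hcαL : |c' * Skeleton.alpha D * Skeleton.ell D| ≤ 1 / 5 := by
    rw [abs_mul, abs_mul, abs_of_pos hαpos, abs_of_pos hLpos]
    linarith
  obtain ⟨hcb1, hcb2⟩ := abs_le.mp hcαL
  have hb1 : |Skeleton.b1 c' D| ≤ 2 * Skeleton.alpha D := by
    rw [Skeleton.b1, abs_mul, abs_of_pos hαpos]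
    have : |1 - 5 * c' * Skeleton.alpha D * Skeleton.ell D| ≤ 2 := by
      rw [abs_le]; constructor <;> nlinarith
    nlinarith [abs_nonneg (1 - 5 * c' * Skeleton.alpha D * Skeleton.ell D)]
  have hb2 : |Skeleton.b2 c' D| ≤ 3 * Skeleton.alpha D := by
    rw [Skeleton.b2, abs_mul, abs_mul, abs_of_pos hαpos, abs_two]
    have : |1 + c' * Skeleton.alpha D * Skeleton.ell D| ≤ 3 / 2 := by
      rw [abs_le]; constructor <;> nlinarith
    nlinarith [abs_nonneg (1 + c' * Skeleton.alpha D * Skeleton.ell D)]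
  have hb3 : |Skeleton.b3 c' D| ≤ 4 * Skeleton.alpha D := by
    rw [Skeleton.b3, abs_mul, abs_mul, abs_of_pos hαpos, abs_of_pos (by norm_num : (0 : ℝ) < 3)]
    have : |1 - c' * Skeleton.alpha D * Skeleton.ell D| ≤ 4 / 3 := by
      rw [abs_le]; constructor <;> nlinarith
    nlinarith [abs_nonneg (1 - c' * Skeleton.alpha D * Skeleton.ell D)]
  refine ⟨hL3, ?_⟩
  calc Bsum c' D ≤ 9 * Skeleton.alpha D := by rw [Bsum]; linarith
    _ = 9 * π / Skeleton.ell D ^ 9 := by rw [hα]; ring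

/-- The smallness of the shifts on the tail ranges: for `𝓛 ≥ 3` and `B ≤ 9π𝓛⁻⁹`,
`B·(3 + 𝓛²) ≤ min(1/8, 36π)` (indeed `≤ 36π𝓛⁻⁷`). [cite: Zhang2022LandauSiegel, §2 (2.13)] -/
theorem Bsum_mul_le {B ℓ : ℝ} (hℓ : 3 ≤ ℓ) (hB : B ≤ 9 * π / ℓ ^ 9) :
    B * (3 + ℓ ^ 2) ≤ 1 / 8 ∧ B * (3 + ℓ ^ 2) ≤ 36 * π := by
  have hℓ1 : 1 ≤ ℓ := by linarith
  have hl9 : 0 < ℓ ^ 9 := by positivity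
  have hℓ2 : 3 ≤ ℓ ^ 2 := by nlinarith
  have h7 : (2187 : ℝ) ≤ ℓ ^ 7 := by
    calc (2187 : ℝ) = 3 ^ 7 := by norm_num
      _ ≤ ℓ ^ 7 := pow_le_pow_left₀ (by norm_num) hℓ 7
  have hmain : B * (3 + ℓ ^ 2) ≤ 36 * π / ℓ ^ 7 := by
    calc B * (3 + ℓ ^ 2) ≤ 9 * π / ℓ ^ 9 * (3 + ℓ ^ 2) :=
          mul_le_mul_of_nonneg_right hB (by positivity)
      _ ≤ 9 * π / ℓ ^ 9 * (4 * ℓ ^ 2) := by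
          apply mul_le_mul_of_nonneg_left _ (by positivity); linarith
      _ = 36 * π / ℓ ^ 7 := by field_simp; ring
  have hl7 : 0 < ℓ ^ 7 := by positivity
  constructor
  · refine hmain.trans ?_
    rw [div_le_iff₀ hl7]
    nlinarith [Real.pi_lt_four]
  · refine hmain.trans ?_
    rw [div_le_iff₀ hl7]
    have : (1 : ℝ) ≤ ℓ ^ 7 := by linarith
    nlinarith [Real.pi_pos]

/-- **`XiZeroTailMean` (GAP-LEDGER `G-d20-1`) HOLDS**: there is an absolute `C` such that for all
large `D`, every real primitive `χ (mod D)`, `j ∈ {1,2,3}`, `d, r ≥ 1` (`dr < P₁`) and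
`1 ≤ x ≤ T`: `Σ_{n<⌈x⌉} |ξ₀ⱼ(n;d,r)|/n ≤ C·𝓛·(1 + log x)³` — indeed `≤ C(1 + log x)³`, uniformly
in `d, r, j` (the hypotheses on `j` and `dr < P₁` are not used). Route: the multiplicative majorant
`g ≥ |ξ₀ⱼ|` of this file and `XiZeroMajorant.sum_div_le_gen`, with `B log p ≤ 1/8` on `p ≤ 2x ≤ 2T`.
[cite: Zhang2022LandauSiegel, §8 p.47 (display before (8.10)); §7 p.33] -/
theorem xiZeroTailMean (c' : ℝ) : ∃ C : ℝ, Skeleton.ForAllLarge fun D _ _ =>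
    ∀ j ∈ ({1, 2, 3} : Finset ℕ), ∀ d r : ℕ, 1 ≤ d → 1 ≤ r →
      ((d * r : ℕ) : ℝ) < Skeleton.P1 D → ∀ x : ℝ, 1 ≤ x → x ≤ Skeleton.bigT D →
        ∑ n ∈ Finset.Ico 1 ⌈x⌉₊, ‖Skeleton.xiZero c' D j n d r‖ / n ≤
          C * Skeleton.ell D * (1 + Real.log x) ^ 3 := by
  set C₀ : ℝ := Real.exp (4 * (3 : ℕ) + (129 / 4 + 5 * M0) * (36 * π) + M0 +
    C5 * LogEulerProduct.tailConst 4) with hC₀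
  refine ⟨C₀, ⌈Real.exp (5 * |c'| * π + 3)⌉₊, fun D _ χ hD _ _ j _ d r _ _ _ x hx1 hxT => ?_⟩
  obtain ⟨hL3, hBle⟩ := three_le_ell_and_Bsum_le hD
  set ℓ := Skeleton.ell D with hℓ
  have hℓ1 : 1 ≤ ℓ := by linarith
  have hB0 := Bsum_nonneg c' D
  obtain ⟨hsmall8, hsmall36⟩ := Bsum_mul_le hL3 hBle
  have hx0 : 0 < x := by linarith
  -- `log x ≤ log T = 𝓛^{1.1} ≤ 𝓛²`
  have hlogx : Real.log x ≤ ℓ ^ 2 := by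
    calc Real.log x ≤ Real.log (Skeleton.bigT D) := Real.log_le_log hx0 hxT
      _ = ℓ ^ (1.1 : ℝ) := by rw [Skeleton.bigT, Real.log_exp]
      _ ≤ ℓ ^ (2 : ℝ) := Real.rpow_le_rpow_of_exponent_le hℓ1 (by norm_num)
      _ = ℓ ^ 2 := Real.rpow_two ℓ
  have hlogx0 : 0 ≤ Real.log x := Real.log_nonneg hx1
  have hlog2 : Real.log 2 ≤ 1 := by
    have := Real.log_le_sub_one_of_pos (show (0:ℝ) < 2 by norm_num); linarith
  -- the smallness `B log y ≤ 1/8` whenever `log y ≤ 3 + 𝓛²`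
  have hBsmall : ∀ y : ℝ, Real.log y ≤ 3 + ℓ ^ 2 → Bsum c' D * Real.log y ≤ 1 / 8 := by
    intro y hy
    calc Bsum c' D * Real.log y ≤ Bsum c' D * (3 + ℓ ^ 2) := mul_le_mul_of_nonneg_left hy hB0
      _ ≤ 1 / 8 := hsmall8
  -- the range `X = max ⌈x⌉ 2 ≤ 2x`
  set X : ℕ := max ⌈x⌉₊ 2 with hXdef
  have hX2 : 2 ≤ X := le_max_right _ _
  have hXle : (X : ℝ) ≤ 2 * x := by
    rw [hXdef, Nat.cast_max]
    refine max_le ?_ (by push_cast; linarith)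
    have := Nat.ceil_lt_add_one hx0.le
    linarith
  have hXpos : (0 : ℝ) < X := by exact_mod_cast (show 0 < X by omega)
  have hlogX : Real.log X ≤ 1 + Real.log x := by
    calc Real.log X ≤ Real.log (2 * x) := Real.log_le_log hXpos hXle
      _ = Real.log 2 + Real.log x := Real.log_mul (by norm_num) hx0.ne'
      _ ≤ 1 + Real.log x := by linarith
  have hlogX0 : 0 ≤ Real.log X := Real.log_nonneg (by exact_mod_cast (show 1 ≤ X by omega))
  have hlog4X : Real.log (4 * X) ≤ 3 + ℓ ^ 2 := by
    have h8 : Real.log (4 * X) ≤ Real.log (8 * x) :=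
      Real.log_le_log (by positivity) (by linarith)
    have h8' : Real.log (8 * x) = 3 * Real.log 2 + Real.log x := by
      rw [Real.log_mul (by norm_num) hx0.ne', show (8 : ℝ) = 2 ^ 3 by norm_num, Real.log_pow]
      push_cast; ring
    linarith
  -- primes `p ≤ X`: `B log p ≤ 1/8`
  have hBp : ∀ p, p.Prime → p ≤ X → Bsum c' D * Real.log p ≤ 1 / 8 := by
    intro p hp hpX
    apply hBsmall
    have hp0 : (0 : ℝ) < p := by exact_mod_cast hp.pos
    calc Real.log p ≤ Real.log X := Real.log_le_log hp0 (by exact_mod_cast hpX)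
      _ ≤ 1 + Real.log x := hlogX
      _ ≤ 3 + ℓ ^ 2 := by linarith
  -- termwise majorant on `n < ⌈x⌉`
  have hterm : ∀ n ∈ Finset.Ico 1 ⌈x⌉₊,
      ‖Skeleton.xiZero c' D j n d r‖ / n ≤ gMaj c' D n / n := by
    intro n hn
    obtain ⟨hn1, hnx⟩ := Finset.mem_Ico.mp hn
    have hn0 : n ≠ 0 := by omega
    have hnx' : (n : ℝ) < x := Nat.lt_ceil.mp hnx
    refine div_le_div_of_nonneg_right (norm_xiZero_le_gMaj c' D hn0 j d r fun q hq => ?_)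
      (Nat.cast_nonneg n)
    apply hBsmall
    have hq0 : (0 : ℝ) < q := by exact_mod_cast (Nat.prime_of_mem_primeFactors hq).pos
    have hqn : (q : ℝ) ≤ n := by exact_mod_cast Nat.le_of_mem_primeFactors hq
    calc Real.log q ≤ Real.log n := Real.log_le_log hq0 hqn
      _ ≤ Real.log x := Real.log_le_log (by exact_mod_cast (show 0 < n by omega)) hnx'.le
      _ ≤ 3 + ℓ ^ 2 := by linarith
  -- assemble
  have hsub : Finset.Ico 1 ⌈x⌉₊ ⊆ Finset.Icc 1 X := by
    intro n hn
    obtain ⟨hn1, hnx⟩ := Finset.mem_Ico.mp hn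
    exact Finset.mem_Icc.mpr ⟨hn1, by omega⟩
  have hmaj := sum_gMaj_div_le c' D hX2 hBp
  have hK0 : 0 ≤ 129 / 4 + 5 * M0 := by linarith [M0_nonneg]
  have hexp : Real.exp (4 * (3 : ℕ) + (129 / 4 + 5 * M0) * Bsum c' D * Real.log (4 * X) + M0 +
      C5 * LogEulerProduct.tailConst 4) ≤ C₀ := by
    rw [hC₀]
    apply Real.exp_le_exp.mpr
    have : (129 / 4 + 5 * M0) * Bsum c' D * Real.log (4 * X) ≤ (129 / 4 + 5 * M0) * (36 * π) := by
      rw [mul_assoc]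
      apply mul_le_mul_of_nonneg_left _ hK0
      calc Bsum c' D * Real.log (4 * X) ≤ Bsum c' D * (3 + ℓ ^ 2) :=
            mul_le_mul_of_nonneg_left hlog4X hB0
        _ ≤ 36 * π := hsmall36
    linarith
  have hC₀0 : 0 ≤ C₀ := (Real.exp_pos _).le
  have hpow : Real.log X ^ (3 : ℕ) ≤ (1 + Real.log x) ^ 3 := pow_le_pow_left₀ hlogX0 hlogX 3
  calc ∑ n ∈ Finset.Ico 1 ⌈x⌉₊, ‖Skeleton.xiZero c' D j n d r‖ / n
      ≤ ∑ n ∈ Finset.Ico 1 ⌈x⌉₊, gMaj c' D n / n := sum_le_sum hterm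
    _ ≤ ∑ n ∈ Finset.Icc 1 X, gMaj c' D n / n :=
        sum_le_sum_of_subset_of_nonneg hsub fun n _ _ =>
          div_nonneg (gMaj_nonneg c' D n) (Nat.cast_nonneg n)
    _ ≤ Real.exp (4 * (3 : ℕ) + (129 / 4 + 5 * M0) * Bsum c' D * Real.log (4 * X) + M0 +
          C5 * LogEulerProduct.tailConst 4) * Real.log X ^ (3 : ℕ) := hmaj
    _ ≤ C₀ * (1 + Real.log x) ^ 3 :=
        mul_le_mul hexp hpow (pow_nonneg hlogX0 3) hC₀0
    _ ≤ C₀ * Skeleton.ell D * (1 + Real.log x) ^ 3 := by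
        rw [mul_assoc]
        refine mul_le_mul_of_nonneg_left ?_ hC₀0
        exact le_mul_of_one_le_left (pow_nonneg (by linarith) 3) hℓ1

end Literature.NumberTheory.LFunctions.Zhang2022.XiZeroMajorant
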